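import Literature.NumberTheory.LFunctions.MatomakiRadziwillTaoPropA3Window
import Literature.NumberTheory.LFunctions.TaoLogElliottProp24OfPropA3With
import Literature.NumberTheory.Sieve.MatomakiRadziwillProp1Partition
import HarnessLib

/-!
# Matomäki–Radziwiłł–Tao 2015, Proposition A.3 (restricted-Halász form) from the range `𝒯₂`

Topic `Literature/NumberTheory/LFunctions`.  Everything in this file is PROVED; no definitions, no named facts.

The proof of Proposition A.3 of K. Matomäki, M. Radziwiłł, T. Tao, *An averaged form of Chowla's conjecture*,
Algebra & Number Theory 9 (2015), Appendix A (arXiv:1503.05121 §6, p. 13) has three steps: (1) "Since the mean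
value theorem gives the bound `O(T/X + 1)`, we can assume `T ≤ X/2`"; (2) the window
`𝒯₀ ∪ 𝒯₁ = {|t - t₁| ≤ (log X)^{1/16}}` around the minimising twist `t₁`, by Halász's theorem; (3) the range
`𝒯₂ = {|t - t₁| ≥ (log X)^{1/16}}`, "in exactly the same way as [MR]" (Lemma A.4 and §8 of Matomäki–Radziwiłł
2016 for the `𝒮`-restricted polynomial).  Steps (1) and (2) are in the tree for the block-RESTRICTED polynomial
(`MRT2015.integral_sq_restrDirichlet_window_le`, middle term `(1 + M) e^{-M/2}`); this file assembles them with
step (3) taken as a hypothesis, in the precise form the complex Matomäki–Radziwiłł argument delivers it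
("Proposition 1 of [MR] for completely multiplicative complex `f` on an interval `[T₀, T] ⊆ [0, X]` at distance
`≥ (log X)^{1/16}` from the minimiser"):

* `MRT2015.integral_restrDirichlet_trivial_le` — step (1), the mean value theorem (MR Lemma 6):
  `∫_{T₀}^{T} |F(1+it)|² ≤ 10 T/X + 72`; `MRT2015.one_le_Q_one_mul_err` — `Q₁ (log Q₁)^{1/3}/P₁^{1/6-η} ≥ 1`;
* `MRT2015.propA3With_exp_half_of_T2` — **Proposition A.3 with middle term `K (1 + M) e^{-M/2}`**
  (`MRT2015.PropA3With (fun M => K * (1 + M) * Real.exp (-M / 2))`, `MatomakiRadziwillTaoPropA3With.lean`) from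
  Khale's Vinogradov–Korobov region (`Khale2024_zeroFreeRegion`, used in step (2)) and the `𝒯₂` hypothesis;
* `MRT2015.Tao2016_prop24_of_T2`, `MRT2015.Tao2016_theorem23_of_T2`, `MRT2015.tao_log_chowla_two_of_T2` — hence
  Tao's Proposition 2.4, Theorem 2.3 / 1.3 and the logarithmically averaged binary Chowla conjecture
  (`TaoLogElliottProp24OfPropA3With.lean`: Theorem A.2 in the same form, the major arcs with `W ≤ e^{M/12}`,
  Theorem 1.7 with saving `e^{-M/120}`).

So the named facts `Tao2016_prop24`, `Tao2016_theorem23`, `tao_log_averaged_elliott_two`, `tao_log_chowla_two`,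
`Sieve.tao_log_chowla_liouville/moebius` are reduced to `Khale2024_zeroFreeRegion` and the `𝒯₂` statement.

## References
* K. Matomäki, M. Radziwiłł, T. Tao, Algebra & Number Theory 9 (2015), Appendix A, Proposition A.3 and its proof.
  [cite: MatomakiRadziwillTao2015, Appendix A, Proposition A.3 (proof)]
* K. Matomäki, M. Radziwiłł, Ann. of Math. 183 (2016), Lemma 6 and §8 (Proposition 1).
  [cite: MatomakiRadziwillAnnals2016, Proposition 1]
* T. Tao, Forum Math. Pi 4 (2016), e8, Proposition 2.4. [cite: TaoFMP2016, Proposition 2.4]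

## Design choices
* The `𝒯₂` input is a hypothesis binder (stated verbatim three times), not a definition: it is the statement the
  complex port of MR §8 is to prove (coefficients `f 1_𝒮`, interval `[T₀, T] ⊆ [0, X]`, minimiser `t₁` with
  `|t₁| ≤ X` and `𝔻(f, n^{it₁}; X)² = M(f; X)`, distance `|t - t₁| ≥ (log X)^{1/16}` on `[T₀, T]`).
* Constants: `K` of the window bound is fixed first; Proposition A.3's constant is `2 max(C_{𝒯₂}, 0) + K + 200`.
-/

noncomputable section

open Finset Real Complex Filter MeasureTheory
open scoped ComplexConjugate Classical

namespace Literature.NumberTheory.LFunctions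

namespace MRT2015

open Sieve (SieveIntervalSystem minPretentiousDistSq minPretentiousDistSq_nonneg pretentiousDistSq)

variable {η X₀ : ℝ}

/-! ### The trivial bound (mean value theorem) for complex coefficients -/

/-- **The trivial bound** `∫_{T₀}^{T} |F(1+it)|² dt ≤ 10 T/X + 72` for `F(1+it) = restrDirichlet f I X t`,
`|f| ≤ 1`, `X ≥ 1`, `0 ≤ T₀ ≤ T`, `0 < T` (Matomäki–Radziwiłł's Lemma 6; the proof of
`Sieve.SieveIntervalSystem.integral_trivial_le` verbatim for complex `f`).  This is the first sentence of the
proof of Proposition A.3: "the mean value theorem gives the bound `O(T/X + 1)`".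
[cite: MatomakiRadziwillTao2015, Appendix A, Proposition A.3 (proof)] -/
theorem integral_restrDirichlet_trivial_le {f : ℕ → ℂ} (hf1 : ∀ n, ‖f n‖ ≤ 1) (I : SieveIntervalSystem η X₀)
    {X : ℝ} (hX : 1 ≤ X) {T₀ T : ℝ} (hT₀ : 0 ≤ T₀) (hT₀T : T₀ ≤ T) (hT : 0 < T) :
    ∫ t in T₀..T, ‖restrDirichlet f I X t‖ ^ 2 ≤ 10 * T / X + 72 := by
  have hX0 : 0 < X := by linarith
  have hsub : (Icc ⌈X⌉₊ ⌊2 * X⌋₊).filter (fun n : ℕ => I.Mem n) ⊆ Icc 1 ⌊2 * X⌋₊ :=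
    (filter_subset _ _).trans (Sieve.MatomakiRadziwillLemma12.Nn_subset hX0)
  have hIcc : Set.Icc T₀ T ⊆ Set.Icc (-T) T := Set.Icc_subset_Icc (by linarith) le_rfl
  have h := Sieve.MatomakiRadziwillLemma12.meanvalue_subset ((Icc ⌈X⌉₊ ⌊2 * X⌋₊).filter (fun n : ℕ => I.Mem n))
    ⌊2 * X⌋₊ hsub f hT hIcc
  unfold restrDirichlet
  rw [intervalIntegral.integral_of_le hT₀T, ← integral_Icc_eq_integral_Ioc]
  refine h.trans ?_
  have hM : (⌊2 * X⌋₊ : ℝ) ≤ 2 * X := Nat.floor_le (by positivity)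
  have hterm : ∀ n ∈ (Icc ⌈X⌉₊ ⌊2 * X⌋₊).filter (fun n : ℕ => I.Mem n), ‖f n‖ ^ 2 / (n : ℝ) ^ 2 ≤ 1 / X ^ 2 := by
    intro n hn
    have hXn : X ≤ n := Nat.ceil_le.1 (mem_Icc.1 (mem_filter.1 hn).1).1
    have h1 : ‖f n‖ ^ 2 ≤ 1 := by
      have := hf1 n
      have h0 := norm_nonneg (f n)
      nlinarith only [this, h0]
    calc ‖f n‖ ^ 2 / (n : ℝ) ^ 2 ≤ 1 / (n : ℝ) ^ 2 := div_le_div_of_nonneg_right h1 (by positivity)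
      _ ≤ 1 / X ^ 2 := div_le_div_of_nonneg_left zero_le_one (by positivity) (pow_le_pow_left₀ hX0.le hXn 2)
  have hcard : (#((Icc ⌈X⌉₊ ⌊2 * X⌋₊).filter (fun n : ℕ => I.Mem n)) : ℝ) ≤ X + 1 := by
    calc (#((Icc ⌈X⌉₊ ⌊2 * X⌋₊).filter (fun n : ℕ => I.Mem n)) : ℝ) ≤ #(Icc ⌈X⌉₊ ⌊2 * X⌋₊) := by
          exact_mod_cast card_filter_le _ _
      _ = ((⌊2 * X⌋₊ + 1 - ⌈X⌉₊ : ℕ) : ℝ) := by rw [Nat.card_Icc]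
      _ ≤ X + 1 := by
          rcases le_or_gt ⌈X⌉₊ (⌊2 * X⌋₊ + 1) with hle | hlt
          · rw [Nat.cast_sub hle]; push_cast; linarith [Nat.le_ceil X]
          · rw [Nat.sub_eq_zero_of_le hlt.le]; push_cast; linarith
  calc (5 * T + 18 * (⌊2 * X⌋₊ : ℝ)) *
        ∑ n ∈ (Icc ⌈X⌉₊ ⌊2 * X⌋₊).filter (fun n : ℕ => I.Mem n), ‖f n‖ ^ 2 / (n : ℝ) ^ 2
      ≤ (5 * T + 36 * X) * ∑ n ∈ (Icc ⌈X⌉₊ ⌊2 * X⌋₊).filter (fun n : ℕ => I.Mem n), (1 / X ^ 2 : ℝ) :=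
        mul_le_mul (by linarith) (sum_le_sum hterm) (sum_nonneg fun n _ => by positivity) (by positivity)
    _ = (5 * T + 36 * X) * (#((Icc ⌈X⌉₊ ⌊2 * X⌋₊).filter (fun n : ℕ => I.Mem n)) * (1 / X ^ 2)) := by
        rw [sum_const, nsmul_eq_mul]
    _ ≤ (5 * T + 36 * X) * ((X + 1) * (1 / X ^ 2)) := by gcongr
    _ ≤ (5 * T + 36 * X) * (2 / X) := by
        refine mul_le_mul_of_nonneg_left ?_ (by positivity)
        rw [show (X + 1) * (1 / X ^ 2) = (X + 1) / X ^ 2 by ring, div_le_div_iff₀ (by positivity) hX0]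
        nlinarith
    _ = 10 * T / X + 72 := by field_simp; ring

/-- `Q₁ (log Q₁)^{1/3}/P₁^{1/6-η} ≥ 1` (`P₁^{1/6-η} ≤ P₁ ≤ Q₁`, `log Q₁ > 1`): the first error term absorbs the
trivial bound `T/X` when `T ≥ X/2`. [folklore] -/
theorem one_le_Q_one_mul_err (I : SieveIntervalSystem η X₀) (hη : 0 < η) (hη6 : η < 1 / 6) :
    1 ≤ I.Q 1 * (Real.log (I.Q 1) ^ (1 / 3 : ℝ) / I.P 1 ^ (1 / 6 - η)) := by
  have hη8 : η ≤ 8 := by linarith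
  have hP1 : 1 ≤ I.P 1 := I.one_le_P_one
  have hPQ : I.P 1 ≤ I.Q 1 := I.P_le_Q 1 le_rfl
  have hlogQ : 1 < Real.log (I.Q 1) := I.one_lt_log_Q_one hη hη8
  have h1 : 1 ≤ Real.log (I.Q 1) ^ (1 / 3 : ℝ) := Real.one_le_rpow hlogQ.le (by norm_num)
  have h2 : I.P 1 ^ (1 / 6 - η) ≤ I.Q 1 :=
    calc I.P 1 ^ (1 / 6 - η) ≤ I.P 1 ^ (1 : ℝ) := Real.rpow_le_rpow_of_exponent_le hP1 (by linarith)
      _ = I.P 1 := Real.rpow_one _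
      _ ≤ I.Q 1 := hPQ
  have h3 : 0 < I.P 1 ^ (1 / 6 - η) := Real.rpow_pos_of_pos (by linarith) _
  rw [mul_div_assoc', le_div_iff₀ h3]
  nlinarith

/-! ### Proposition A.3 from the window bound and the range `𝒯₂` -/

/-- (From any Vinogradov–Korobov region `HasVKZeroFreeRegion cVK TVK`, `cVK > 0`.)  **Proposition A.3 with middle term `K (1 + M) e^{-M/2}`, from the bound on `𝒯₂`.**  Assume Khale's theorem
(for the window `𝒯₀ ∪ 𝒯₁`, `integral_sq_restrDirichlet_window_le`) and the following form of "Matomäki–Radziwiłł's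
Proposition 1 for complex `f` away from the minimiser" (the printed "In the region `|t - t₁| ≥ (log X)^{1/16}` …
exactly the same way as [MR]", i.e. Lemma A.4 and MR §8 for the `𝒮`-restricted polynomial): for `η ∈ (0, 1/6)`
there are `C, Xη` such that for `X > Xη`, `√X ≤ X₀ ≤ X`, completely multiplicative `1`-bounded `f`, a minimiser
`t₁` of `u ↦ 𝔻(f, n^{iu}; X)²` on `|u| ≤ X`, and `0 ≤ T₀ ≤ T ≤ X` with `|t - t₁| ≥ (log X)^{1/16}` on `[T₀, T]`,
`∫_{T₀}^{T} |F(1+it)|² dt ≤ C (T/(X/Q₁) + 1) ((log Q₁)^{1/3}/P₁^{1/6-η} + (log X)^{-1/50})`.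
Then `MRT2015.PropA3With (fun M => K (1 + M) e^{-M/2})` holds for some `K ≥ 0`.
Proof (as printed): for `T ≥ X/2` the mean value theorem (`integral_restrDirichlet_trivial_le`,
`one_le_Q_one_mul_err`); for `T < X/2` split `[0, T]` at `a = clamp(t₁ - L)`, `b = clamp(t₁ + L)`, `L = (log X)^{1/16}`
(`clamp = max 0 ∘ min T`), use the hypothesis on `[0, a]` and `[b, T]` and the window bound on `[a, b]`.
[cite: MatomakiRadziwillTao2015, Appendix A, Proposition A.3 (proof)] -/
theorem propA3With_exp_half_of_T2_of_vk {cVK TVK : ℝ} (hcVK : 0 < cVK) (hVK : HasVKZeroFreeRegion cVK TVK)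
    (hT2 : ∀ η : ℝ, 0 < η → η < 1 / 6 → ∃ C Xη : ℝ, ∀ (X X₀ T₀ T t₁ : ℝ) (I : SieveIntervalSystem η X₀)
      (f : ArithmeticFunction ℂ), (∀ m n : ℕ, f (m * n) = f m * f n) → f 1 = 1 → (∀ n, ‖f n‖ ≤ 1) →
      Xη < X → Real.sqrt X ≤ X₀ → X₀ ≤ X → |t₁| ≤ X →
      pretentiousDistSq f (fun n : ℕ => (n : ℂ) ^ ((t₁ : ℂ) * Complex.I)) X = minPretentiousDistSq f X X →
      0 ≤ T₀ → T₀ ≤ T → T ≤ X →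
      (∀ t ∈ Set.Icc T₀ T, Real.log X ^ (1 / 16 : ℝ) ≤ |t - t₁|) →
      ∫ t in T₀..T, ‖restrDirichlet f I X t‖ ^ 2 ≤
        C * (T / (X / I.Q 1) + 1) *
          (Real.log (I.Q 1) ^ (1 / 3 : ℝ) / (I.P 1) ^ (1 / 6 - η) + 1 / Real.log X ^ (1 / 50 : ℝ))) :
    ∃ K : ℝ, 0 ≤ K ∧ PropA3With (fun M => K * (1 + M) * Real.exp (-M / 2)) := by
  obtain ⟨K, hK0, hWev⟩ := integral_sq_restrDirichlet_window_le_of_vk hcVK hVK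
  obtain ⟨Xw, hW⟩ := Filter.eventually_atTop.1 hWev
  refine ⟨K, hK0.le, ?_⟩
  intro η hη hη6
  obtain ⟨C₂, Xη, hT2'⟩ := hT2 η hη hη6
  refine ⟨2 * max C₂ 0 + K + 200, max (max Xη Xw) 64, ?_⟩
  intro X X₀ T I f hf hf1 hfb hXη hX₀ hX₀X hT0
  have hXη' : Xη < X := lt_of_le_of_lt ((le_max_left _ _).trans (le_max_left _ _)) hXη
  have hXw : Xw ≤ X := ((le_max_right _ _).trans (le_max_left _ _)).trans hXη.le
  have hX64 : 64 ≤ X := (le_max_right _ _).trans hXη.le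
  have hX0 : 0 < X := by linarith
  have hX1 : 1 ≤ X := by linarith
  have hη8 : η ≤ 8 := by linarith
  -- notation for the error terms
  set E₁ : ℝ := Real.log (I.Q 1) ^ (1 / 3 : ℝ) / I.P 1 ^ (1 / 6 - η) with hE₁
  set E₃ : ℝ := 1 / Real.log X ^ (1 / 50 : ℝ) with hE₃
  set M : ℝ := minPretentiousDistSq f X X with hMdef
  set mid : ℝ := K * (1 + M) * Real.exp (-M / 2) with hmid
  set R : ℝ := T / (X / I.Q 1) + 1 with hR
  have hQ1 : 1 ≤ I.Q 1 := I.one_le_Q hη hη8 le_rfl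
  have hQ0 : 0 < I.Q 1 := by linarith
  have hlogX : 0 < Real.log X := Real.log_pos (by linarith)
  have hP0 : 0 < I.P 1 := I.pos_P 1 le_rfl
  have hE₁0 : 0 ≤ E₁ := by
    have : 0 ≤ Real.log (I.Q 1) := Real.log_nonneg hQ1
    positivity
  have hE₃0 : 0 ≤ E₃ := by positivity
  have hM0 : 0 ≤ M := minPretentiousDistSq_nonneg hfb X hX0.le
  have hmid0 : 0 ≤ mid := by positivity
  have hR1 : 1 ≤ R := by
    have : 0 ≤ T / (X / I.Q 1) := by positivity
    linarith
  have hR0 : 0 ≤ R := by linarith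
  have hRdef : R = T * I.Q 1 / X + 1 := by rw [hR]; field_simp
  have hC₂ : C₂ ≤ max C₂ 0 := le_max_left _ _
  have hC₂0 : 0 ≤ max C₂ 0 := le_max_right _ _
  -- the goal, restated
  show ∫ t in (0 : ℝ)..T, ‖restrDirichlet f I X t‖ ^ 2 ≤ (2 * max C₂ 0 + K + 200) * R * (E₁ + mid + E₃)
  have hcont : Continuous fun t : ℝ => ‖restrDirichlet f I X t‖ ^ 2 :=
    ((continuous_restrDirichlet f I X).norm).pow 2
  have hint : ∀ a b : ℝ, IntervalIntegrable (fun t : ℝ => ‖restrDirichlet f I X t‖ ^ 2) volume a b :=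
    fun a b => hcont.intervalIntegrable _ _
  have hnn : ∀ a b : ℝ, a ≤ b → 0 ≤ ∫ t in a..b, ‖restrDirichlet f I X t‖ ^ 2 := fun a b hab =>
    intervalIntegral.integral_nonneg hab fun t _ => by positivity
  rcases le_or_gt (X / 2) T with hTX | hTX
  · -- `T ≥ X/2`: the trivial bound
    have hT : 0 < T := by linarith
    have h1 := integral_restrDirichlet_trivial_le hfb I hX1 le_rfl hT0 hT
    have h2 : 10 * T / X + 72 ≤ 154 * (T / X) := by
      have : 1 / 2 ≤ T / X := by rw [div_le_div_iff₀ (by norm_num) hX0]; linarith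
      have h' : 10 * T / X = 10 * (T / X) := by ring
      rw [h']; linarith
    have h3 : T / X ≤ R * E₁ := by
      have h4 := one_le_Q_one_mul_err I hη hη6
      have hTX0 : 0 ≤ T / X := by positivity
      calc T / X = T / X * 1 := (mul_one _).symm
        _ ≤ T / X * (I.Q 1 * E₁) := mul_le_mul_of_nonneg_left h4 hTX0
        _ = (T * I.Q 1 / X) * E₁ := by ring
        _ ≤ R * E₁ := by rw [hRdef]; exact mul_le_mul_of_nonneg_right (by linarith) hE₁0
    have h5 : R * E₁ ≤ R * (E₁ + mid + E₃) := mul_le_mul_of_nonneg_left (by linarith) hR0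
    have h6 : 0 ≤ R * (E₁ + mid + E₃) := by positivity
    nlinarith
  · -- `T < X/2`: split `[0, T]`
    obtain ⟨t₁, ht₁, -, heq⟩ := Halasz.Restricted.exists_isMinOn_pretentiousDistSq_twist hfb X hX0.le
    set L : ℝ := Real.log X ^ (1 / 16 : ℝ) with hL
    have hL0 : 0 < L := Real.rpow_pos_of_pos hlogX _
    set a : ℝ := max 0 (min T (t₁ - L)) with ha
    set b : ℝ := max 0 (min T (t₁ + L)) with hb
    have ha0 : 0 ≤ a := le_max_left _ _
    have hb0 : 0 ≤ b := le_max_left _ _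
    have haT : a ≤ T := max_le hT0 (min_le_left _ _)
    have hbT : b ≤ T := max_le hT0 (min_le_left _ _)
    have hab : a ≤ b := max_le_max le_rfl (min_le_min le_rfl (by linarith))
    -- the three pieces
    rw [← intervalIntegral.integral_add_adjacent_intervals (hint 0 a) (hint a T),
      ← intervalIntegral.integral_add_adjacent_intervals (hint a b) (hint b T)]
    -- piece `[0, a]`
    have hA : ∫ t in (0 : ℝ)..a, ‖restrDirichlet f I X t‖ ^ 2 ≤ max C₂ 0 * R * (E₁ + E₃) := by
      rcases eq_or_lt_of_le ha0 with h0 | h0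
      · rw [← h0, intervalIntegral.integral_same]; positivity
      · -- `a > 0`: `a = min T (t₁ - L) ≤ t₁ - L`
        have ha' : a ≤ t₁ - L := by
          have : a = min T (t₁ - L) := max_eq_right (le_of_lt (by
            rcases lt_or_ge 0 (min T (t₁ - L)) with h' | h'
            · exact h'
            · exfalso; rw [ha, max_eq_left h'] at h0; exact lt_irrefl _ h0))
          rw [this]; exact min_le_right _ _
        have hfar : ∀ t ∈ Set.Icc 0 a, L ≤ |t - t₁| := by
          intro t ht
          rw [abs_sub_comm, abs_of_nonneg (by linarith [ht.2])]
          linarith [ht.2]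
        have h := hT2' X X₀ 0 a t₁ I f hf hf1 hfb hXη' hX₀ hX₀X ht₁ heq le_rfl ha0 (by linarith) hfar
        refine h.trans ?_
        have hRa : a / (X / I.Q 1) + 1 ≤ R := by
          rw [hR]; gcongr
        have hRa0 : 0 ≤ a / (X / I.Q 1) + 1 := by positivity
        have hEE : 0 ≤ E₁ + E₃ := by positivity
        calc C₂ * (a / (X / I.Q 1) + 1) * (E₁ + E₃) ≤ max C₂ 0 * (a / (X / I.Q 1) + 1) * (E₁ + E₃) := by
              gcongr
          _ ≤ max C₂ 0 * R * (E₁ + E₃) := by gcongr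
    -- piece `[b, T]`
    have hB : ∫ t in b..T, ‖restrDirichlet f I X t‖ ^ 2 ≤ max C₂ 0 * R * (E₁ + E₃) := by
      rcases eq_or_lt_of_le hbT with h0 | h0
      · rw [h0, intervalIntegral.integral_same]; positivity
      · -- `b < T`: `b = max 0 (t₁ + L) ≥ t₁ + L`
        have hb' : t₁ + L ≤ b := by
          have hmin : min T (t₁ + L) = t₁ + L := by
            rcases le_or_gt T (t₁ + L) with h' | h'
            · exfalso
              have : b = T := by rw [hb, min_eq_left h', max_eq_right hT0]
              exact lt_irrefl _ (this ▸ h0)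
            · exact min_eq_right h'.le
          rw [hb, hmin]; exact le_max_right _ _
        have hfar : ∀ t ∈ Set.Icc b T, L ≤ |t - t₁| := by
          intro t ht
          rw [abs_of_nonneg (by linarith [ht.1])]
          linarith [ht.1]
        have h := hT2' X X₀ b T t₁ I f hf hf1 hfb hXη' hX₀ hX₀X ht₁ heq hb0 hbT (by linarith) hfar
        refine h.trans ?_
        have hEE : 0 ≤ E₁ + E₃ := by positivity
        gcongr
    -- piece `[a, b]`: the window
    have hWin : ∫ t in a..b, ‖restrDirichlet f I X t‖ ^ 2 ≤ K * ((1 + M) * Real.exp (-M / 2) + E₃) := by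
      rcases eq_or_lt_of_le hab with h0 | h0
      · rw [← h0, intervalIntegral.integral_same]; positivity
      · -- `a < b`: `a ≥ t₁ - L` (as `a < T`) and `b ≤ t₁ + L` (as `b > 0`)
        have ha' : t₁ - L ≤ a := by
          have haT' : a < T := lt_of_lt_of_le h0 hbT
          have hmin : min T (t₁ - L) = t₁ - L := by
            rcases le_or_gt T (t₁ - L) with h' | h'
            · exfalso
              have : a = T := by rw [ha, min_eq_left h', max_eq_right hT0]
              exact lt_irrefl _ (this ▸ haT')
            · exact min_eq_right h'.le
          rw [ha, hmin]; exact le_max_right _ _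
        have hb' : b ≤ t₁ + L := by
          have hb0' : 0 < b := lt_of_le_of_lt ha0 h0
          have : b = min T (t₁ + L) := max_eq_right (le_of_lt (by
            rcases lt_or_ge 0 (min T (t₁ + L)) with h' | h'
            · exact h'
            · exfalso; rw [hb, max_eq_left h'] at hb0'; exact lt_irrefl _ hb0'))
          rw [this]; exact min_le_right _ _
        exact hW X hXw η X₀ I f hη (by linarith) hf hf1 hfb hX₀ hX₀X t₁ a b heq.le hab ha' hb'
          (by linarith) (by linarith)
    -- combine
    have hWin' : K * ((1 + M) * Real.exp (-M / 2) + E₃) ≤ R * (mid + K * E₃) := by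
      have h1 : K * ((1 + M) * Real.exp (-M / 2) + E₃) = mid + K * E₃ := by rw [hmid]; ring
      rw [h1]
      exact le_mul_of_one_le_left (by positivity) hR1
    have hsum := add_le_add hA (add_le_add hWin hB)
    refine hsum.trans ?_
    clear hsum hA hB hWin hW hT2' hint hcont hnn heq
    have h1 : 0 ≤ max C₂ 0 * R * mid := by positivity
    have h2 : 0 ≤ K * R * E₁ := by positivity
    have h3 : 0 ≤ K * R * mid := by positivity
    have h4 : 0 ≤ R * mid := by positivity
    have h5 : 0 ≤ R * E₁ := by positivity
    have h6 : 0 ≤ R * E₃ := by positivity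
    linarith [hWin', h1, h2, h3, h4, h5, h6]

/-- **Proposition A.3 with middle term `K (1 + M) e^{-M/2}`, from the bound on `𝒯₂`.**  Assume Khale's theorem
(for the window `𝒯₀ ∪ 𝒯₁`, `integral_sq_restrDirichlet_window_le`) and the following form of "Matomäki–Radziwiłł's
Proposition 1 for complex `f` away from the minimiser" (the printed "In the region `|t - t₁| ≥ (log X)^{1/16}` …
exactly the same way as [MR]", i.e. Lemma A.4 and MR §8 for the `𝒮`-restricted polynomial): for `η ∈ (0, 1/6)`
there are `C, Xη` such that for `X > Xη`, `√X ≤ X₀ ≤ X`, completely multiplicative `1`-bounded `f`, a minimiser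
`t₁` of `u ↦ 𝔻(f, n^{iu}; X)²` on `|u| ≤ X`, and `0 ≤ T₀ ≤ T ≤ X` with `|t - t₁| ≥ (log X)^{1/16}` on `[T₀, T]`,
`∫_{T₀}^{T} |F(1+it)|² dt ≤ C (T/(X/Q₁) + 1) ((log Q₁)^{1/3}/P₁^{1/6-η} + (log X)^{-1/50})`.
Then `MRT2015.PropA3With (fun M => K (1 + M) e^{-M/2})` holds for some `K ≥ 0`.
Proof (as printed): for `T ≥ X/2` the mean value theorem (`integral_restrDirichlet_trivial_le`,
`one_le_Q_one_mul_err`); for `T < X/2` split `[0, T]` at `a = clamp(t₁ - L)`, `b = clamp(t₁ + L)`, `L = (log X)^{1/16}`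
(`clamp = max 0 ∘ min T`), use the hypothesis on `[0, a]` and `[b, T]` and the window bound on `[a, b]`.
[cite: MatomakiRadziwillTao2015, Appendix A, Proposition A.3 (proof)] -/
theorem propA3With_exp_half_of_T2 (hK : Khale2024_zeroFreeRegion)
    (hT2 : ∀ η : ℝ, 0 < η → η < 1 / 6 → ∃ C Xη : ℝ, ∀ (X X₀ T₀ T t₁ : ℝ) (I : SieveIntervalSystem η X₀)
      (f : ArithmeticFunction ℂ), (∀ m n : ℕ, f (m * n) = f m * f n) → f 1 = 1 → (∀ n, ‖f n‖ ≤ 1) →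
      Xη < X → Real.sqrt X ≤ X₀ → X₀ ≤ X → |t₁| ≤ X →
      pretentiousDistSq f (fun n : ℕ => (n : ℂ) ^ ((t₁ : ℂ) * Complex.I)) X = minPretentiousDistSq f X X →
      0 ≤ T₀ → T₀ ≤ T → T ≤ X →
      (∀ t ∈ Set.Icc T₀ T, Real.log X ^ (1 / 16 : ℝ) ≤ |t - t₁|) →
      ∫ t in T₀..T, ‖restrDirichlet f I X t‖ ^ 2 ≤
        C * (T / (X / I.Q 1) + 1) *
          (Real.log (I.Q 1) ^ (1 / 3 : ℝ) / (I.P 1) ^ (1 / 6 - η) + 1 / Real.log X ^ (1 / 50 : ℝ))) :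
    ∃ K : ℝ, 0 ≤ K ∧ PropA3With (fun M => K * (1 + M) * Real.exp (-M / 2))  :=
  propA3With_exp_half_of_T2_of_vk (by norm_num) (hasVKZeroFreeRegion_of_khale hK) hT2

/-! ### Tao's Proposition 2.4 and its consequences from the `𝒯₂` bound -/

/-- (From any Vinogradov–Korobov region `HasVKZeroFreeRegion cVK TVK`, `cVK > 0`.)  **Tao 2016, Proposition 2.4, from Khale's theorem and the `𝒯₂` bound** (`propA3With_exp_half_of_T2`, then
`Tao2016_prop24_of_propA3With_exp_half`: Theorem A.2, the major arcs with `W ≤ e^{M/12}`, Theorem 2.3,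
Theorem 1.7 with `e^{-M/120}`, Proposition 2.4). [cite: TaoFMP2016, Proposition 2.4] -/
theorem Tao2016_prop24_of_T2_of_vk {cVK TVK : ℝ} (hcVK : 0 < cVK) (hVK : HasVKZeroFreeRegion cVK TVK)
    (hT2 : ∀ η : ℝ, 0 < η → η < 1 / 6 → ∃ C Xη : ℝ, ∀ (X X₀ T₀ T t₁ : ℝ) (I : SieveIntervalSystem η X₀)
      (f : ArithmeticFunction ℂ), (∀ m n : ℕ, f (m * n) = f m * f n) → f 1 = 1 → (∀ n, ‖f n‖ ≤ 1) →
      Xη < X → Real.sqrt X ≤ X₀ → X₀ ≤ X → |t₁| ≤ X →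
      pretentiousDistSq f (fun n : ℕ => (n : ℂ) ^ ((t₁ : ℂ) * Complex.I)) X = minPretentiousDistSq f X X →
      0 ≤ T₀ → T₀ ≤ T → T ≤ X →
      (∀ t ∈ Set.Icc T₀ T, Real.log X ^ (1 / 16 : ℝ) ≤ |t - t₁|) →
      ∫ t in T₀..T, ‖restrDirichlet f I X t‖ ^ 2 ≤
        C * (T / (X / I.Q 1) + 1) *
          (Real.log (I.Q 1) ^ (1 / 3 : ℝ) / (I.P 1) ^ (1 / 6 - η) + 1 / Real.log X ^ (1 / 50 : ℝ))) :
    Tao2016_prop24 := by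
  obtain ⟨K, hK0, h⟩ := propA3With_exp_half_of_T2_of_vk hcVK hVK hT2
  exact Tao2016_prop24_of_propA3With_exp_half hK0 h

/-- **Tao 2016, Proposition 2.4, from Khale's theorem and the `𝒯₂` bound** (`propA3With_exp_half_of_T2`, then
`Tao2016_prop24_of_propA3With_exp_half`: Theorem A.2, the major arcs with `W ≤ e^{M/12}`, Theorem 2.3,
Theorem 1.7 with `e^{-M/120}`, Proposition 2.4). [cite: TaoFMP2016, Proposition 2.4] -/
theorem Tao2016_prop24_of_T2 (hK : Khale2024_zeroFreeRegion)
    (hT2 : ∀ η : ℝ, 0 < η → η < 1 / 6 → ∃ C Xη : ℝ, ∀ (X X₀ T₀ T t₁ : ℝ) (I : SieveIntervalSystem η X₀)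
      (f : ArithmeticFunction ℂ), (∀ m n : ℕ, f (m * n) = f m * f n) → f 1 = 1 → (∀ n, ‖f n‖ ≤ 1) →
      Xη < X → Real.sqrt X ≤ X₀ → X₀ ≤ X → |t₁| ≤ X →
      pretentiousDistSq f (fun n : ℕ => (n : ℂ) ^ ((t₁ : ℂ) * Complex.I)) X = minPretentiousDistSq f X X →
      0 ≤ T₀ → T₀ ≤ T → T ≤ X →
      (∀ t ∈ Set.Icc T₀ T, Real.log X ^ (1 / 16 : ℝ) ≤ |t - t₁|) →
      ∫ t in T₀..T, ‖restrDirichlet f I X t‖ ^ 2 ≤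
        C * (T / (X / I.Q 1) + 1) *
          (Real.log (I.Q 1) ^ (1 / 3 : ℝ) / (I.P 1) ^ (1 / 6 - η) + 1 / Real.log X ^ (1 / 50 : ℝ))) :
    Tao2016_prop24  :=
  Tao2016_prop24_of_T2_of_vk (by norm_num) (hasVKZeroFreeRegion_of_khale hK) hT2

/-- (From any Vinogradov–Korobov region `HasVKZeroFreeRegion cVK TVK`, `cVK > 0`.)  Tao 2016, Theorem 2.3, from Khale's theorem and the `𝒯₂` bound. [cite: TaoFMP2016, Theorem 2.3] -/
theorem Tao2016_theorem23_of_T2_of_vk {cVK TVK : ℝ} (hcVK : 0 < cVK) (hVK : HasVKZeroFreeRegion cVK TVK)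
    (hT2 : ∀ η : ℝ, 0 < η → η < 1 / 6 → ∃ C Xη : ℝ, ∀ (X X₀ T₀ T t₁ : ℝ) (I : SieveIntervalSystem η X₀)
      (f : ArithmeticFunction ℂ), (∀ m n : ℕ, f (m * n) = f m * f n) → f 1 = 1 → (∀ n, ‖f n‖ ≤ 1) →
      Xη < X → Real.sqrt X ≤ X₀ → X₀ ≤ X → |t₁| ≤ X →
      pretentiousDistSq f (fun n : ℕ => (n : ℂ) ^ ((t₁ : ℂ) * Complex.I)) X = minPretentiousDistSq f X X →
      0 ≤ T₀ → T₀ ≤ T → T ≤ X →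
      (∀ t ∈ Set.Icc T₀ T, Real.log X ^ (1 / 16 : ℝ) ≤ |t - t₁|) →
      ∫ t in T₀..T, ‖restrDirichlet f I X t‖ ^ 2 ≤
        C * (T / (X / I.Q 1) + 1) *
          (Real.log (I.Q 1) ^ (1 / 3 : ℝ) / (I.P 1) ^ (1 / 6 - η) + 1 / Real.log X ^ (1 / 50 : ℝ))) :
    Tao2016_theorem23 :=
  Tao2016_theorem23_of_prop24 (Tao2016_prop24_of_T2_of_vk hcVK hVK hT2)

/-- Tao 2016, Theorem 2.3, from Khale's theorem and the `𝒯₂` bound. [cite: TaoFMP2016, Theorem 2.3] -/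
theorem Tao2016_theorem23_of_T2 (hK : Khale2024_zeroFreeRegion)
    (hT2 : ∀ η : ℝ, 0 < η → η < 1 / 6 → ∃ C Xη : ℝ, ∀ (X X₀ T₀ T t₁ : ℝ) (I : SieveIntervalSystem η X₀)
      (f : ArithmeticFunction ℂ), (∀ m n : ℕ, f (m * n) = f m * f n) → f 1 = 1 → (∀ n, ‖f n‖ ≤ 1) →
      Xη < X → Real.sqrt X ≤ X₀ → X₀ ≤ X → |t₁| ≤ X →
      pretentiousDistSq f (fun n : ℕ => (n : ℂ) ^ ((t₁ : ℂ) * Complex.I)) X = minPretentiousDistSq f X X →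
      0 ≤ T₀ → T₀ ≤ T → T ≤ X →
      (∀ t ∈ Set.Icc T₀ T, Real.log X ^ (1 / 16 : ℝ) ≤ |t - t₁|) →
      ∫ t in T₀..T, ‖restrDirichlet f I X t‖ ^ 2 ≤
        C * (T / (X / I.Q 1) + 1) *
          (Real.log (I.Q 1) ^ (1 / 3 : ℝ) / (I.P 1) ^ (1 / 6 - η) + 1 / Real.log X ^ (1 / 50 : ℝ))) :
    Tao2016_theorem23  :=
  Tao2016_theorem23_of_T2_of_vk (by norm_num) (hasVKZeroFreeRegion_of_khale hK) hT2

/-- (From any Vinogradov–Korobov region `HasVKZeroFreeRegion cVK TVK`, `cVK > 0`.)  The logarithmically averaged binary Chowla conjecture (`tao_log_chowla_two`), from Khale's theorem and the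
`𝒯₂` bound. [cite: TaoFMP2016, Corollary 1.5] -/
theorem tao_log_chowla_two_of_T2_of_vk {cVK TVK : ℝ} (hcVK : 0 < cVK) (hVK : HasVKZeroFreeRegion cVK TVK)
    (hT2 : ∀ η : ℝ, 0 < η → η < 1 / 6 → ∃ C Xη : ℝ, ∀ (X X₀ T₀ T t₁ : ℝ) (I : SieveIntervalSystem η X₀)
      (f : ArithmeticFunction ℂ), (∀ m n : ℕ, f (m * n) = f m * f n) → f 1 = 1 → (∀ n, ‖f n‖ ≤ 1) →
      Xη < X → Real.sqrt X ≤ X₀ → X₀ ≤ X → |t₁| ≤ X →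
      pretentiousDistSq f (fun n : ℕ => (n : ℂ) ^ ((t₁ : ℂ) * Complex.I)) X = minPretentiousDistSq f X X →
      0 ≤ T₀ → T₀ ≤ T → T ≤ X →
      (∀ t ∈ Set.Icc T₀ T, Real.log X ^ (1 / 16 : ℝ) ≤ |t - t₁|) →
      ∫ t in T₀..T, ‖restrDirichlet f I X t‖ ^ 2 ≤
        C * (T / (X / I.Q 1) + 1) *
          (Real.log (I.Q 1) ^ (1 / 3 : ℝ) / (I.P 1) ^ (1 / 6 - η) + 1 / Real.log X ^ (1 / 50 : ℝ))) :
    tao_log_chowla_two :=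
  tao_log_chowla_two_of_prop24 (Tao2016_prop24_of_T2_of_vk hcVK hVK hT2)

/-- The logarithmically averaged binary Chowla conjecture (`tao_log_chowla_two`), from Khale's theorem and the
`𝒯₂` bound. [cite: TaoFMP2016, Corollary 1.5] -/
theorem tao_log_chowla_two_of_T2 (hK : Khale2024_zeroFreeRegion)
    (hT2 : ∀ η : ℝ, 0 < η → η < 1 / 6 → ∃ C Xη : ℝ, ∀ (X X₀ T₀ T t₁ : ℝ) (I : SieveIntervalSystem η X₀)
      (f : ArithmeticFunction ℂ), (∀ m n : ℕ, f (m * n) = f m * f n) → f 1 = 1 → (∀ n, ‖f n‖ ≤ 1) →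
      Xη < X → Real.sqrt X ≤ X₀ → X₀ ≤ X → |t₁| ≤ X →
      pretentiousDistSq f (fun n : ℕ => (n : ℂ) ^ ((t₁ : ℂ) * Complex.I)) X = minPretentiousDistSq f X X →
      0 ≤ T₀ → T₀ ≤ T → T ≤ X →
      (∀ t ∈ Set.Icc T₀ T, Real.log X ^ (1 / 16 : ℝ) ≤ |t - t₁|) →
      ∫ t in T₀..T, ‖restrDirichlet f I X t‖ ^ 2 ≤
        C * (T / (X / I.Q 1) + 1) *
          (Real.log (I.Q 1) ^ (1 / 3 : ℝ) / (I.P 1) ^ (1 / 6 - η) + 1 / Real.log X ^ (1 / 50 : ℝ))) :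
    tao_log_chowla_two  :=
  tao_log_chowla_two_of_T2_of_vk (by norm_num) (hasVKZeroFreeRegion_of_khale hK) hT2

end MRT2015

end Literature.NumberTheory.LFunctions

end
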